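import Mathlib
import HarnessLib

/-!
# courier split of the staged transcript `OSWMechanismSinkEntry.lean` — part 01 of 01

1-D model (gCLM/OSW), computer-assisted; not Euler/NS.  Filed under `Summits/NavierStokesRegularity/OSWSelfSimilar/` by a prover-role courier on behalf of the
mechanism seat pub-oswblow-mech (planner-pub-oswblow-mech-g31-0), cell pub-oswblow (host summit NavierStokesRegularity); the gate admits the path but
not role planner.  CONTENT = the staged transcript `pub-oswblow-mech/lean/OSWMechanismSinkEntry.lean` (sha256 8eabcc89ff8a20d5…,
168 lines), source lines 32–168, UNCHANGED except: (i) namespace prefix `OSWSelfSimilar.Mechanism` → `Summit.NavierStokesRegularity.OSWSelfSimilar.Mechanism`;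
(ii) [parts >= 02 only: the frames open at the cut are re-opened above the body and closed at the end; nothing to re-open here]
(iii) this docstring and, below it, the transcript's own module documentation VERBATIM (renamed).  Generated by `pub-oswblow-mech/lean/courier/make_split.py`; the parts must be filed IN ORDER
(each imports its predecessor).  First/last declarations here: `curvature_sink_identity` … `ConeSetIsUnionOfComponents` (14 in this part).
AI-written transcript; kernel-checked on the farm as ONE file before splitting (see the kit's CHECKS); to be checked, not trusted.
-/

/-!
# OSW self-similar mechanism — entry of the cone at p = 3 (MECHANISM §36, v31)

1-D model (gCLM/OSW), computer-assisted; not Euler/NS.  AI-written; to be checked, not trusted.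
Staged companion file (NOT filed in the tree; no axiom, no sorry).

Notation of MECHANISM §35.19/§36: at the sink `x = π - θ`, a profile has
`u = F/sin x = κ θ^{p-1} E(θ)` with `E(θ) = (θ/sin θ) e^{Λ_π(θ)}`; `δ = θ d/dθ`;
`S = sin θ/θ`, `T = (sin θ - θ cos θ)/θ³` (so `sin θ = θ S`, `cos θ = S - θ² T`);
the c-curvature is `d²u/dc² = N/sin³θ`, `N = u_θθ sin θ - u_θ cos θ` (`c = 1 - cos x`).

Kernel-checked here (pointwise polynomial identities and inequalities; the calculus facts
`θ u_θ = δu`, `θ² u_θθ = δ²u - δu` for `u = κ θ^{p-1} E` enter as hypotheses `Hu1`, `Hu2`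
with `Q` standing for `θ^{p-1}`):
* `curvature_sink_identity` — PROPOSITION 36.2, identity (36.2);
* `second_order_bookkeeping` — the expansion (36.3) after inserting `E = 1 + e₂θ² + r_E`;
* `mu2_profile_variables`, `e2_cfrak` — (36.4): `μ₂` in profile variables, `1/3 + 4e₂ = 1 + 2μ₂`;
* `strain_curvature_at_sink` — `h''(π) = B₀ - 6 G₂` as a coefficient identity;
* `cfrak_decomp`, `cfrak_numerator_pos`, `cfrak_pos_at_three`, `cfrak_uniform_ninth` —
  LEMMA 36.3: at `p = 3` the sink curvature coefficient `𝔠_π = 1 + h''(π)(1-2B₀)/(B₀(1+B₀))`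
  is `≥ (2-B₀)/(1+B₀) > 0` whenever `h''(π) ≤ B₀` (THEOREM M41) and `1/2 < B₀ < 2`, and the
  uniform bound `1 + 2μ₂ ≥ 1/9` on the box `p ∈ [5/2, 4]`, `B₀ ∈ (1/2, 5/4]`;
* `B0_window_at_three` — at `p = 3`, `B₀ = 1/(3a-1) ∈ (1/2, 5/4)` for `a ∈ (3/5, 1)`;
* `component_subset_of_relClopen` — the topological skeleton of THEOREM M46: a subset `Σ ⊆ P`
  which is clopen relative to `P` contains the connected component (in `P`) of each of its points.
Typed, NOT proved (no axiom, no sorry): `EntryAtThree` — the analytic statement of THEOREM M46,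
proved in MECHANISM.md §36.5 on paper, not kernel-checked.
-/

namespace Summit.NavierStokesRegularity.OSWSelfSimilar.Mechanism.SinkEntry

/-- PROPOSITION 36.2, identity (36.2), pointwise polynomial form.  `Q = θ^{p-1}`,
`u1 = u_θ`, `u2 = u_θθ`, `E1 = δE`, `E2 = δ²E`, `sθ = sin θ`, `cθ = cos θ`. -/
theorem curvature_sink_identity
    (κ θ p Q S T E E1 E2 u1 u2 sθ cθ : ℝ)
    (Hsin : sθ = θ * S) (Hcos : cθ = S - θ ^ 2 * T)
    (Hu1 : θ * u1 = κ * Q * ((p - 1) * E + E1))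
    (Hu2 : θ ^ 2 * u2 = κ * Q * ((p - 1) * (p - 2) * E + (2 * p - 3) * E1 + E2)) :
    θ ^ 2 * (u2 * sθ - u1 * cθ)
      = κ * Q * θ * ((p - 1) * (p - 3) * S * E + (p - 1) * θ ^ 2 * T * E
                      + ((2 * p - 4) * S + θ ^ 2 * T) * E1 + S * E2) := by
  linear_combination (θ * S) * Hu2 - (θ * (S - θ ^ 2 * T)) * Hu1
    + (θ ^ 2 * u2) * Hsin - (θ * (θ * u1)) * Hcos

/-- (36.3): inserting `E = 1 + e₂θ² + r`, `δE = 2e₂θ² + r1`, `δ²E = 4e₂θ² + r2` into the bracket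
of (36.2). -/
theorem second_order_bookkeeping (p θ S T e2 r r1 r2 : ℝ) :
    (p - 1) * (p - 3) * S * (1 + e2 * θ ^ 2 + r) + (p - 1) * θ ^ 2 * T * (1 + e2 * θ ^ 2 + r)
      + ((2 * p - 4) * S + θ ^ 2 * T) * (2 * e2 * θ ^ 2 + r1) + S * (4 * e2 * θ ^ 2 + r2)
    = (p - 1) * (p - 3) * S * (1 + e2 * θ ^ 2 + r)
      + (p - 1) * θ ^ 2 * (T * (1 + e2 * θ ^ 2 + r) + 4 * e2 * S)
      + 2 * e2 * θ ^ 4 * T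
      + (((2 * p - 4) * S + θ ^ 2 * T) * r1 + S * r2) := by
  ring

/-- (36.4): `μ₂ = p h₂ (ε - 2b)/(6 b (ε + b))` written in profile variables `h₂ = ε h''`,
`b = ε B₀`: `μ₂ = p h'' (1 - 2B₀)/(6 B₀ (1 + B₀))`. -/
theorem mu2_profile_variables (p ε B0 hpp : ℝ) (hε : ε ≠ 0) (hB : B0 ≠ 0) (hB1 : 1 + B0 ≠ 0) :
    p * (ε * hpp) * (ε - 2 * (ε * B0)) / (6 * (ε * B0) * (ε + ε * B0))
      = p * hpp * (1 - 2 * B0) / (6 * B0 * (1 + B0)) := by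
  field_simp

/-- (36.4): with `e₂ = 1/6 + μ₂/2`, the `p = 3` sink curvature coefficient is
`1/3 + 4 e₂ = 1 + 2 μ₂ =: 𝔠_π`. -/
theorem e2_cfrak (μ2 e2 : ℝ) (he : e2 = 1 / 6 + μ2 / 2) : 1 / 3 + 4 * e2 = 1 + 2 * μ2 := by
  subst he; ring

/-- (36.4): `μ₂ = p h₂(ε-2b)/(6ab²)` equals `p · h₂ (ε - 2b)/(6 b (ε+b))` when `p = (ε+b)/(ab)`,
here in the division-free form. -/
theorem mu2_two_forms (a b ε h2 p : ℝ) (hp : p * (a * b) = ε + b) :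
    (h2 * (ε - 2 * b)) * (6 * b * (ε + b)) = (p * h2 * (ε - 2 * b)) * (6 * a * b ^ 2) := by
  rw [← hp]; ring

/-- LEMMA 36.3, the strain curvature at the sink: if `g(π-θ) = (B₀ + G₂θ² + …)(θ - θ³/6 + …)`
and `g(π-θ) = B₀θ - h''(π)θ³/6 + …` (`g_x = h`, `h(π) = -B₀`, `h'(π) = 0`), comparing the
`θ³`-coefficients gives `h''(π) = B₀ - 6G₂`. -/
theorem strain_curvature_at_sink (B0 G2 hpp : ℝ) :
    G2 - B0 / 6 = -hpp / 6 ↔ hpp = B0 - 6 * G2 := by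
  constructor <;> intro h <;> linarith

/-- LEMMA 36.3, decomposition (36.7) of `𝔠_π` at `p = 3` with `h''(π) = B₀ - 6G₂`. -/
theorem cfrak_decomp (B0 G2 : ℝ) (hB : B0 ≠ 0) (hB1 : 1 + B0 ≠ 0) :
    1 + (B0 - 6 * G2) * (1 - 2 * B0) / (B0 * (1 + B0))
      = (2 - B0) / (1 + B0) + 6 * G2 * (2 * B0 - 1) / (B0 * (1 + B0)) := by
  field_simp
  ring

/-- LEMMA 36.3, the a-priori sign: `B₀(1+B₀)·𝔠_π = B₀(1+B₀) + h''(π)(1-2B₀) ≥ B₀(2-B₀) > 0`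
whenever `h''(π) ≤ B₀` (from THEOREM M41: `G ≥ B₀`, i.e. `G₂ ≥ 0`) and `1/2 ≤ B₀ < 2`. -/
theorem cfrak_numerator_pos (B0 hpp : ℝ) (hB : 1 / 2 ≤ B0) (hB2 : B0 < 2) (hh : hpp ≤ B0) :
    B0 * (2 - B0) ≤ B0 * (1 + B0) + hpp * (1 - 2 * B0)
      ∧ 0 < B0 * (1 + B0) + hpp * (1 - 2 * B0) := by
  have e : B0 * (1 + B0) + hpp * (1 - 2 * B0)
      = B0 * (2 - B0) + (B0 - hpp) * (2 * B0 - 1) := by ring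
  have h1 : 0 ≤ (B0 - hpp) * (2 * B0 - 1) := mul_nonneg (by linarith) (by linarith)
  have h2 : 0 < B0 * (2 - B0) := mul_pos (by linarith) (by linarith)
  constructor <;> linarith

/-- LEMMA 36.3 at `p = 3`: `𝔠_π = 1 + h''(π)(1-2B₀)/(B₀(1+B₀)) ≥ (2-B₀)/(1+B₀) > 0`. -/
theorem cfrak_pos_at_three (B0 hpp : ℝ) (hB : 1 / 2 ≤ B0) (hB2 : B0 < 2) (hh : hpp ≤ B0) :
    (2 - B0) / (1 + B0) ≤ 1 + hpp * (1 - 2 * B0) / (B0 * (1 + B0))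
      ∧ 0 < 1 + hpp * (1 - 2 * B0) / (B0 * (1 + B0)) := by
  have hB0 : 0 < B0 := by linarith
  have hB1 : 0 < 1 + B0 := by linarith
  have hD : 0 < B0 * (1 + B0) := mul_pos hB0 hB1
  obtain ⟨hle, hpos⟩ := cfrak_numerator_pos B0 hpp hB hB2 hh
  have key : 1 + hpp * (1 - 2 * B0) / (B0 * (1 + B0))
      = (B0 * (1 + B0) + hpp * (1 - 2 * B0)) / (B0 * (1 + B0)) := by
    field_simp
  have e1 : (2 - B0) / (1 + B0) = (B0 * (2 - B0)) / (B0 * (1 + B0)) := by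
    field_simp
  constructor
  · rw [key, e1]
    gcongr
  · rw [key]; exact div_pos hpos hD

/-- LEMMA 36.3, uniform version used in the proof of THEOREM M46: on the box `5/2 ≤ p ≤ 4`,
`1/2 ≤ B₀ ≤ 5/4`, with `h''(π) ≤ B₀`: `1 + 2μ₂ = 1 + p h''(1-2B₀)/(3B₀(1+B₀)) ≥ 1/9`, in the
division-free form `8 B₀(1+B₀) + 3 p h'' (1 - 2B₀) ≥ 0` (equality at `p = 4`, `B₀ = 5/4`, `h'' = B₀`). -/
theorem cfrak_uniform_ninth (p B0 hpp : ℝ) (hp : 5 / 2 ≤ p) (hp4 : p ≤ 4)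
    (hB : 1 / 2 ≤ B0) (hB54 : B0 ≤ 5 / 4) (hh : hpp ≤ B0) :
    0 ≤ 8 * B0 * (1 + B0) + 3 * p * hpp * (1 - 2 * B0) := by
  have h1 : 0 ≤ (B0 - hpp) * (2 * B0 - 1) := mul_nonneg (by linarith) (by linarith)
  have h2 : 0 ≤ p := by linarith
  have h3 : 0 ≤ 3 * p * ((B0 - hpp) * (2 * B0 - 1)) := by positivity
  have h4 : 0 ≤ (4 - p) * (2 * B0 - 1) := mul_nonneg (by linarith) (by linarith)
  have h5 : 0 ≤ B0 * ((4 - p) * (2 * B0 - 1)) := mul_nonneg (by linarith) h4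
  have e : 8 * B0 * (1 + B0) + 3 * p * hpp * (1 - 2 * B0)
      = 4 * B0 * (5 - 4 * B0) + 3 * B0 * ((4 - p) * (2 * B0 - 1))
        + 3 * p * ((B0 - hpp) * (2 * B0 - 1)) * 1 - 0 := by ring
  nlinarith

/-- At `p = 3` (`p = (1+B₀)/(aB₀)`, i.e. `3aB₀ = 1 + B₀`) with `3/5 < a < 1`: `1/2 < B₀ < 5/4`. -/
theorem B0_window_at_three (a B0 : ℝ) (ha : 3 / 5 < a) (ha1 : a < 1) (hB0 : 0 < B0)
    (hq : 3 * a * B0 = 1 + B0) : 1 / 2 < B0 ∧ B0 < 5 / 4 := by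
  constructor <;> nlinarith

/-- Topological skeleton of THEOREM M46 (STRUCTURE OF Σ): if `Sg ⊆ P` (the cone set Σ of §36) and `Sg` is clopen in the
relative topology of `P`, then `Sg` contains the connected component in `P` of each of its points;
hence it is a union of connected components of `P`.  (In §36: `P = {σ ∈ J : p(σ) ≥ 3}`,
`Σ = {σ ∈ J : u(σ) ∈ 𝒞}`.) -/
theorem component_subset_of_relClopen {X : Type*} [TopologicalSpace X] {P Sg : Set X}
    (hSP : Sg ⊆ P) (hclopen : IsClopen ((Subtype.val : P → X) ⁻¹' Sg)) {x : X} (hx : x ∈ Sg) :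
    connectedComponentIn P x ⊆ Sg := by
  have hxP : x ∈ P := hSP hx
  rw [connectedComponentIn_eq_image hxP]
  rintro y ⟨y', hy', rfl⟩
  have hx' : (⟨x, hxP⟩ : P) ∈ (Subtype.val : P → X) ⁻¹' Sg := by simpa using hx
  exact hclopen.connectedComponent_subset hx' hy'

/-- THEOREM M46 (ENTRY AT p = 3), typed paraphrase — PROVED in MECHANISM.md §36.5 on paper,
NOT kernel-checked; stated as a `Prop`-valued definition, asserted nowhere.  The analytic data
are parameters: `J` the parameter interval of a continuous path in the solution set `S`,
`p σ` the sink exponent, `inS σ` = 'F(σ)/sin x is non-increasing' (the class 𝒮),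
`inCone σ` = 'u(σ) is in the periodic HQWW cone 𝒞'. -/
def EntryAtThree (J : Set ℝ) (p : ℝ → ℝ) (inS inCone : ℝ → Prop) : Prop :=
  ∀ σ₀ ∈ J, inS σ₀ → p σ₀ = 3 → inCone σ₀ →
    ∃ δ > 0, ∀ σ ∈ J, |σ - σ₀| < δ → (inCone σ ↔ 3 ≤ p σ)

/-- STRUCTURE clause of THEOREM M46, typed paraphrase (proved on paper, §36.5; not kernel-checked
beyond `component_subset_of_relClopen`): along every continuous path in `S` through a profile of
𝒮, the cone set is a union of connected components of `{p ≥ 3}`. -/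
def ConeSetIsUnionOfComponents (J : Set ℝ) (p : ℝ → ℝ) (inCone : ℝ → Prop) : Prop :=
  ∀ σ₀ ∈ J, inCone σ₀ → connectedComponentIn {σ | σ ∈ J ∧ 3 ≤ p σ} σ₀ ⊆ {σ | inCone σ}

end Summit.NavierStokesRegularity.OSWSelfSimilar.Mechanism.SinkEntry
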